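import Summits.QuantumFields.BalabanUV.T4Continuum.Support.B13InnerData
import Summits.QuantumFields.BalabanUV.T4Continuum.Support.B13DomainGeometryTR
import Summits.QuantumFields.BalabanUV.T4Continuum.Support.TorusBlockRefinement

/-!
# SUBSTRATE — THE CARRIERS' ADJACENT SCALES ARE pv22's NESTED TORI: the TYPE transport `TDom 4 (L·N′) ≃ TDom 4 (R.cubesPerDir k)`
# (`N′ := R.cubesPerDir (k+1)`, `R.cubesPerDir k = L·N′` for `k + 1 + m′ ≤ m + K`), its compatibility with the two block maps
# (pv22 `tcoarse L N′` = the carriers' `B13InnerData.coarsen R k (k+1)`), the embedding `fineEmb` of the fine torus into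
# `R.carriers.Dom` at scale `k`, the carriers' `Within` read torus-side (crew's `trefineDom` is well-formedness's «Z₀ within Z»),
# and the transport of row NE5's inner labels `InnerLabel` with the `WF` ∕ `innerLabels` dictionary (answer (a)∕(b) to Q-NE1p-emb)

Cell `pub-balaban`, SUBSTRATE cell, seat `b2b-balaban-substrate-p1` (gen 6; [dict] layer of the cell's brief — NE1′ F-2 junction).
Summits-side under the LEAN PLACEMENT RULE (cell bookkeeping).  HONEST FRAMING: rung (B)+1 of the FINITE-VOLUME T⁴ programme — NOT
infinite volume, NOT a mass gap, NOT Clay; spine PROVED 0∕9; NE1′ ∕ NE5 NOT PRINTED ∕ NOT PROVED.  HONEST DEPENDENCY (cell line,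
verbatim): continuum YM on T⁴ ⇐ BetaPertH ∧ nine spine estimates (0/9 proved); BetaPertH ⇐ (D1) ∧ (D4) ∧ CAP+tail; G-an2-4 gates
asym, D1 and NE2/3/4.

THE QUESTION (row NE1′ owner, Q-NE1p-emb, journal l.18210 ∕ l.21599): name the objects of record for `emb` (the step geometry's polymer
↦ its carrier domain), `foot` (its conditioning domain one scale down) and `terms` (which inner labels), so that the owner's ENDs
(`Spine/NE1p/DressedSmallFieldRecordLabels` §2) instantiate BY NAME on the carriers of record `R : B13Carriers.TwoRuns G`
(`R.carriers.Dom = Σ j, TDom 4 (R.cubesPerDir j)`, row NE5 O1-a).  The rfl-level half is in the tree: `(tsys 4 (R.cubesPerDir (k+1))).Dom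
= TDom 4 (R.cubesPerDir (k+1))`, `emb := B13DomainGeometryTR.domEmb R (k+1)` (`⟨k+1, ·⟩`), `R.carriers.scale (emb Z) = k+1`,
`R.carriers.d (emb Z) = torusTreeLen Z.1`, `B13InnerData.innerLevel R (k+1) = R.domAt k`.  THE MISSING HALF (this file): the NE1′
crew's nested tori are `(N′, L·N′)` (`Support/TorusBlockRefinement.trefineDom L N′ : TDom 4 N′ → TDom 4 (L·N′)`, pv22's block map
`TreeLengthTorusTransfer.tcoarse L N′`), whereas the carriers' scale-`k` catalogue is `TDom 4 (R.cubesPerDir k)` with `R.cubesPerDir k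
= R.F.L · R.cubesPerDir (k+1)` only PROPOSITIONALLY (`cubesPerDir_eq_mul_succ`, under `k + 1 + R.m′ ≤ R.F.m + R.K`): a transport of
types is needed, and it must commute with the block maps and preserve the tree length.

WHAT (defs + theorems; nothing existing is modified; imports `B13InnerData` (p208616) + `B13DomainGeometryTR` (p208152) + the NE1′
crew's `Support/TorusBlockRefinement` (S43 PART 1) ONLY):
* §1 (generic, `N = M`): `tptCast h : TPt d N ≃ TPt d M` (coordinatewise `ZMod.ringEquivCongr`) and `tdomCast h : TDom d N ≃ TDom d M`
  with their `rfl`∕`symm`∕`val`∕`TAdj`∕`TFaceConnected`∕`torusTreeLen`∕`card`∕membership lemmas (rewriting without `subst`).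
* §2 (carriers): `cubesPerDir_eq_mul_succ`; `finePt R hk : TPt 4 (R.F.L · R.cubesPerDir (k+1)) ≃ TPt 4 (R.cubesPerDir k)`,
  `fineDom R hk`, **`fineEmb R hk : TDom 4 (R.F.L · R.cubesPerDir (k+1)) ↪ R.carriers.Dom`** (`= ⟨k, fineDom R hk Y⟩`; `scale = k`,
  `d = torusTreeLen Y.1`, `∈ R.domAt k = innerLevel R (k+1)`, and every scale-`k` carrier domain is in its range);
  **`coarsen_finePt : B13InnerData.coarsen R k (k+1) (finePt R hk a) = tcoarse R.F.L (R.cubesPerDir (k+1)) a`**;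
  **`within_fineEmb_domEmb_iff : Within R (fineEmb R hk Y) (domEmb R (k+1) Z) ↔ Y.1.image (tcoarse …) ⊆ Z.1`**,
  `within_fineEmb_fineEmb_iff` (same scale: `↔ Y.1 ⊆ Z₀.1`), **`within_fineEmb_trefineDom`** (the crew's refinement of `Z` lies
  within `Z`: `image_tcoarse_trefine`) and `d_domEmb_le_d_fineEmb_trefineDom` (`hmono` on the carriers: `torusTreeLen_le_trefine`).
* §3 (labels): `InnerLabel.ofTorus R hk : InnerLabel (TDom 4 (L·N′)) (Bnd R) → InnerLabel R.carriers.Dom (Bnd R)`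
  (`⟨fineEmb Z₀, fam.map fineEmb, P⟩`), `ofTorus_injective`, **`wf_ofTorus_iff`** (`WF (b13InnerData R) (k+1) (domEmb R (k+1) Z)`
  ⟺ `(∀ Y ∈ fam, Y.1 ⊆ Z₀.1) ∧ P ⊆ bondsIn R (fineEmb Z₀) ∧ Z₀.1.image (tcoarse …) ⊆ Z.1` — the two catalogue clauses hold
  automatically), `exists_ofTorus_eq_of_wf` (every well-formed label at `domEmb R (k+1) Z` is the image of a torus label),
  `torusLabels R hk Z` + `mem_torusLabels_iff` + **`innerLabels_domEmb_eq_map_torusLabels`** + `sum_innerLabels_domEmb_eq`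
  (row NE5's catalogue `innerLabels (b13InnerData R) (k+1) (domEmb R (k+1) Z)` IS the image of the torus labels, so owner-side
  filters `terms Z := (torusLabels R hk Z).filter (fine Z)` and sums transport by `Finset.sum_map`).
HONEST: a dictionary between accepted modules; nothing of (B1b)∕(B3) or of any estimate is discharged; 0 sorry.
-/

noncomputable section

open scoped BigOperators

namespace Summit.QuantumFields.BalabanUV.T4Continuum.SubstrateNestedToriOfRecord

open Literature.MathematicalPhysics.QuantumFieldTheory.Balaban1983to89
open Literature.MathematicalPhysics.QuantumFieldTheory.Balaban1983to89.B13ScaleTransfer (Pt coarse)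
open Literature.MathematicalPhysics.QuantumFieldTheory.Balaban1983to89.TreeLengthTorus
open Literature.MathematicalPhysics.QuantumFieldTheory.Balaban1983to89.TreeLengthTorusTransfer (tcoarse)
open Literature.MathematicalPhysics.QuantumFieldTheory.Balaban1983to89.T4Continuum (T4Family)
open Summit.QuantumFields.BalabanUV.T4Continuum.B13Carriers (TwoRuns)
open Summit.QuantumFields.BalabanUV.T4Continuum.B13DomainGeometryTR (domEmb domEmb_apply domAt_eq_map)
open Summit.QuantumFields.BalabanUV.T4Continuum.B13InnerData (Bnd coarsen coarsen_apply innerLevel innerLevel_succ bondsIn Within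
  within_iff within_iff_of_fst_eq b13InnerData b13InnerData_within)
open Summit.QuantumFields.BalabanUV.T4Continuum.B13StepTermLabels (InnerLabel InnerData innerLabels mem_innerLabels)
open Summit.QuantumFields.BalabanUV.T4Continuum.TorusBlockRefinement (trefine trefineDom trefineDom_val image_tcoarse_trefine
  torusTreeLen_le_trefine)

/-! ## §1 Transport of cube indices and torus domains along an equality of cube counts -/

section Cast

variable {d N M : ℕ}

/-- [folklore] **TRANSPORT OF CUBE INDICES** along an equality `N = M` of cube counts: coordinatewise `ZMod.ringEquivCongr`. -/
def tptCast (h : N = M) : TPt d N ≃ TPt d M :=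
  Equiv.piCongrRight fun _ => (ZMod.ringEquivCongr h).toEquiv

/-- [folklore] The transport, coordinatewise. -/
@[simp] theorem tptCast_apply (h : N = M) (a : TPt d N) (i : Fin d) : tptCast h a i = ZMod.ringEquivCongr h (a i) := rfl

/-- [folklore] The transport preserves the standard representatives. -/
@[simp] theorem val_tptCast (h : N = M) (a : TPt d N) (i : Fin d) : (tptCast h a i).val = (a i).val := by
  rw [tptCast_apply, ZMod.ringEquivCongr_val]

/-- [folklore] Along `rfl` the transport is the identity. -/
@[simp] theorem tptCast_rfl : tptCast (d := d) (rfl : N = N) = Equiv.refl _ := by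
  ext a i
  simp

/-- [folklore] The inverse transport is the transport along the symmetric equality. -/
@[simp] theorem tptCast_symm (h : N = M) : (tptCast (d := d) h).symm = tptCast h.symm := by
  subst h; simp

/-- [folklore] The standard lift to the universal cover is transport-invariant. -/
@[simp] theorem natLift_tptCast [NeZero N] [NeZero M] (h : N = M) (a : TPt d N) : natLift (tptCast h a) = natLift a := by
  subst h; simp

/-- [folklore] Torus wall adjacency is transport-invariant. -/
theorem tadj_tptCast_iff (h : N = M) {a b : TPt d N} : TAdj (tptCast h a) (tptCast h b) ↔ TAdj a b := by
  subst h; simp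

/-- [folklore] Torus-face-connectedness is transport-invariant. -/
theorem tFaceConnected_map_tptCast_iff (h : N = M) {X : Finset (TPt d N)} :
    TFaceConnected (X.map (tptCast h).toEmbedding) ↔ TFaceConnected X := by
  subst h; simp

/-- [folklore] Being a torus localization domain is transport-invariant. -/
theorem isTDom_map_tptCast_iff (h : N = M) {X : Finset (TPt d N)} : IsTDom (X.map (tptCast h).toEmbedding) ↔ IsTDom X := by
  subst h; simp

/-- [folklore] **THE TREE LENGTH IS TRANSPORT-INVARIANT**: `torusTreeLen (X.map (tptCast h)) = torusTreeLen X`. -/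
@[simp] theorem torusTreeLen_map_tptCast (h : N = M) (X : Finset (TPt d N)) :
    torusTreeLen (X.map (tptCast h).toEmbedding) = torusTreeLen X := by
  subst h; simp

variable [NeZero N] [NeZero M]

/-- [folklore] **TRANSPORT OF TORUS LOCALIZATION DOMAINS** `TDom d N ≃ TDom d M` along `N = M` (cube sets mapped by `tptCast`). -/
def tdomCast (h : N = M) : TDom d N ≃ TDom d M where
  toFun Z := ⟨Z.1.map (tptCast h).toEmbedding, (isTDom_map_tptCast_iff h).2 Z.2⟩
  invFun W := ⟨W.1.map (tptCast h.symm).toEmbedding, (isTDom_map_tptCast_iff h.symm).2 W.2⟩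
  left_inv Z := by subst h; apply Subtype.ext; simp
  right_inv W := by subst h; apply Subtype.ext; simp

/-- [folklore] The cubes of the transported domain. -/
@[simp] theorem tdomCast_val (h : N = M) (Z : TDom d N) : (tdomCast h Z).1 = Z.1.map (tptCast h).toEmbedding := rfl

/-- [folklore] The cubes of the inverse-transported domain. -/
@[simp] theorem tdomCast_symm_val (h : N = M) (W : TDom d M) :
    ((tdomCast (d := d) h).symm W).1 = W.1.map (tptCast h.symm).toEmbedding := rfl
/-- [folklore] The inverse transport of domains is the transport along the symmetric equality. -/
theorem tdomCast_symm (h : N = M) : (tdomCast (d := d) h).symm = tdomCast h.symm := by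
  subst h; rfl

/-- [folklore] The tree length of a transported domain is unchanged. -/
@[simp] theorem torusTreeLen_tdomCast (h : N = M) (Z : TDom d N) : torusTreeLen (tdomCast h Z).1 = torusTreeLen Z.1 := by
  rw [tdomCast_val, torusTreeLen_map_tptCast]

/-- [folklore] The number of cubes of a transported domain is unchanged. -/
@[simp] theorem card_tdomCast (h : N = M) (Z : TDom d N) : (tdomCast h Z).1.card = Z.1.card := by
  rw [tdomCast_val, Finset.card_map]

/-- [folklore] Membership in a transported domain. -/
theorem mem_tdomCast_iff (h : N = M) (Z : TDom d N) (b : TPt d M) : b ∈ (tdomCast h Z).1 ↔ tptCast h.symm b ∈ Z.1 := by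
  subst h; simp

/-- [folklore] A transported cube lies in the transported domain iff the cube lies in the domain. -/
@[simp] theorem tptCast_mem_tdomCast_iff (h : N = M) (Z : TDom d N) (a : TPt d N) : tptCast h a ∈ (tdomCast h Z).1 ↔ a ∈ Z.1 := by
  subst h; simp

/-- [folklore] Inclusion of cube sets is transport-invariant. -/
theorem tdomCast_val_subset_iff (h : N = M) (Y Z : TDom d N) : (tdomCast h Y).1 ⊆ (tdomCast h Z).1 ↔ Y.1 ⊆ Z.1 := by
  rw [tdomCast_val, tdomCast_val, Finset.map_subset_map]

end Cast

/-! ## §2 The carriers' scale-`k` catalogue read from the fine torus `L·N′`, `N′ := R.cubesPerDir (k+1)` -/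

/-- [folklore] The block size of a torus family is nonzero (`2 ≤ L`). -/
instance instNeZeroFamilyL (F : T4Family) : NeZero F.L := ⟨by have := F.hL; omega⟩

section Carriers

variable {G : Type} [GaugeGroup G] (R : TwoRuns G)

/-- [folklore] **ADJACENT SCALES DIFFER BY THE BLOCK FACTOR**: `R.cubesPerDir k = R.F.L · R.cubesPerDir (k+1)` on the standing range
`k + 1 + m′ ≤ m + K` (both are `2·L^{m+K−(·+m′)}`; `TreeLengthTorus.sitesPerDir_eq_pow_mul`). -/
theorem cubesPerDir_eq_mul_succ {k : ℕ} (hk : k + 1 + R.m' ≤ R.F.m + R.K) : R.cubesPerDir k = R.F.L * R.cubesPerDir (k + 1) := by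
  have h := sitesPerDir_eq_pow_mul (R.F.P R.K) (j := k + R.m') (k := k + 1 + R.m') (by omega)
    (by simp only [T4Family.P_m, T4Family.P_K]; omega)
  have e : k + 1 + R.m' - (k + R.m') = 1 := by omega
  rw [e, pow_one, T4Family.P_L] at h
  simpa only [TwoRuns.cubesPerDir, show k + 1 + R.m' = (k + 1) + R.m' from rfl] using h

variable {R}
variable {k : ℕ} (hk : k + 1 + R.m' ≤ R.F.m + R.K)

/-- [folklore] **THE FINE TORUS's CUBES ARE THE CARRIERS' SCALE-`k` CUBE INDICES**: transport `TPt 4 (L·N′) ≃ TPt 4 (R.cubesPerDir k)`. -/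
def finePt : TPt 4 (R.F.L * R.cubesPerDir (k + 1)) ≃ TPt 4 (R.cubesPerDir k) := tptCast (cubesPerDir_eq_mul_succ R hk).symm

/-- [folklore] **THE FINE TORUS's DOMAINS ARE THE CARRIERS' SCALE-`k` TORUS DOMAINS**: transport `TDom 4 (L·N′) ≃ TDom 4 (R.cubesPerDir k)`. -/
def fineDom : TDom 4 (R.F.L * R.cubesPerDir (k + 1)) ≃ TDom 4 (R.cubesPerDir k) := tdomCast (cubesPerDir_eq_mul_succ R hk).symm

/-- [folklore] The cubes of a transported fine domain. -/
@[simp] theorem fineDom_val (Y : TDom 4 (R.F.L * R.cubesPerDir (k + 1))) : (fineDom hk Y).1 = Y.1.map (finePt hk).toEmbedding := rfl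

/-- [folklore] The transport preserves standard representatives. -/
@[simp] theorem val_finePt (a : TPt 4 (R.F.L * R.cubesPerDir (k + 1))) (ν : Fin 4) : (finePt hk a ν).val = (a ν).val :=
  val_tptCast _ a ν

/-- [folklore] **THE FINE TORUS EMBEDS INTO THE CARRIERS' DOMAINS AT SCALE `k`**: `Y ↦ ⟨k, fineDom Y⟩`. -/
def fineEmb : TDom 4 (R.F.L * R.cubesPerDir (k + 1)) ↪ R.carriers.Dom := (fineDom hk).toEmbedding.trans (domEmb R k)

/-- [folklore] `fineEmb Y = ⟨k, fineDom Y⟩`. -/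
@[simp] theorem fineEmb_apply (Y : TDom 4 (R.F.L * R.cubesPerDir (k + 1))) : fineEmb hk Y = ⟨k, fineDom hk Y⟩ := rfl

/-- [folklore] The embedded fine domain has scale `k`. -/
@[simp] theorem scale_fineEmb (Y : TDom 4 (R.F.L * R.cubesPerDir (k + 1))) : R.carriers.scale (fineEmb hk Y) = k := rfl

/-- [folklore] **THE CARRIERS' LINEAR SIZE OF THE EMBEDDED DOMAIN IS THE FINE TORUS's TREE LENGTH** (`= (tsys 4 (L·N′)).dj Y`). -/
@[simp] theorem d_fineEmb (Y : TDom 4 (R.F.L * R.cubesPerDir (k + 1))) : R.carriers.d (fineEmb hk Y) = torusTreeLen Y.1 := by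
  rw [fineEmb_apply, TwoRuns.carriers_d]
  exact torusTreeLen_tdomCast _ Y

/-- [folklore] The carriers' linear size of the embedded domain, as the torus system's `dj`. -/
theorem d_fineEmb_eq_dj (Y : TDom 4 (R.F.L * R.cubesPerDir (k + 1))) : R.carriers.d (fineEmb hk Y) = (tsys 4 (R.F.L * R.cubesPerDir (k + 1))).dj Y := by
  rw [d_fineEmb, tsys_dj]

/-- [folklore] The embedded fine domain lies in the catalogue `𝐃_k`. -/
theorem fineEmb_mem_domAt (Y : TDom 4 (R.F.L * R.cubesPerDir (k + 1))) : fineEmb hk Y ∈ R.domAt k :=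
  (TwoRuns.mem_domAt R).2 rfl

/-- [folklore] **THE EMBEDDED FINE DOMAIN LIES IN ROW NE5's INNER CATALOGUE OF OUTPUT LEVEL `k+1`** (`innerLevel R (k+1) = R.domAt k`). -/
theorem fineEmb_mem_innerLevel (Y : TDom 4 (R.F.L * R.cubesPerDir (k + 1))) : fineEmb hk Y ∈ innerLevel R (k + 1) := by
  rw [innerLevel_succ]; exact fineEmb_mem_domAt hk Y

/-- [folklore] Every scale-`k` carrier domain IS an embedded fine domain. -/
theorem exists_fineEmb_eq_of_scale_eq {X : R.carriers.Dom} (hX : R.carriers.scale X = k) :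
    ∃ Y : TDom 4 (R.F.L * R.cubesPerDir (k + 1)), fineEmb hk Y = X := by
  obtain ⟨j, W⟩ := X
  simp only [TwoRuns.carriers_scale] at hX
  subst hX
  exact ⟨(fineDom hk).symm W, by rw [fineEmb_apply, Equiv.apply_symm_apply]⟩

/-- [folklore] Every domain of the catalogue `𝐃_k` IS an embedded fine domain. -/
theorem exists_fineEmb_eq_of_mem_domAt {X : R.carriers.Dom} (hX : X ∈ R.domAt k) :
    ∃ Y : TDom 4 (R.F.L * R.cubesPerDir (k + 1)), fineEmb hk Y = X :=
  exists_fineEmb_eq_of_scale_eq hk ((TwoRuns.mem_domAt R).1 hX)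

/-- [folklore] **THE TWO BLOCK MAPS AGREE THROUGH THE TRANSPORT**: the carriers' coarsening `π_k → π_{k+1}` of a transported fine cube IS
pv22's block map `tcoarse L N′` of the cube (`⌊a∕L⌋` coordinatewise on both sides). -/
theorem coarsen_finePt (a : TPt 4 (R.F.L * R.cubesPerDir (k + 1))) :
    coarsen R k (k + 1) (finePt hk a) = tcoarse R.F.L (R.cubesPerDir (k + 1)) a := by
  funext ν
  rw [coarsen_apply, val_finePt, show k + 1 - k = 1 by omega, pow_one]
  simp only [tcoarse, proj_apply, coarse, natLift]
  rw [← Int.natCast_div, Int.cast_natCast]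

/-- [folklore] The image of a transported fine domain under the carriers' coarsening is the image of the domain under pv22's block map. -/
theorem image_coarsen_fineDom (Y : TDom 4 (R.F.L * R.cubesPerDir (k + 1))) :
    (fineDom hk Y).1.image (coarsen R k (k + 1)) = Y.1.image (tcoarse R.F.L (R.cubesPerDir (k + 1))) := by
  rw [fineDom_val, Finset.map_eq_image, Finset.image_image]
  exact Finset.image_congr fun a _ => coarsen_finePt hk a

/-- [folklore] **CROSS-LEVEL INCLUSION, READ TORUS-SIDE**: the embedded fine domain `Y` lies `Within` the scale-`(k+1)` domain
`domEmb R (k+1) Z` iff the block family of `Y` lies in `Z` (`Y.1.image (tcoarse L N′) ⊆ Z.1`). -/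
theorem within_fineEmb_domEmb_iff (Y : TDom 4 (R.F.L * R.cubesPerDir (k + 1))) (Z : TDom 4 (R.cubesPerDir (k + 1))) :
    Within R (fineEmb hk Y) (domEmb R (k + 1) Z) ↔ Y.1.image (tcoarse R.F.L (R.cubesPerDir (k + 1))) ⊆ Z.1 := by
  rw [within_iff, fineEmb_apply, domEmb_apply]
  simp only [Nat.le_succ, true_and]
  rw [image_coarsen_fineDom]

/-- [folklore] **SAME-LEVEL INCLUSION, READ TORUS-SIDE**: `Within R (fineEmb Y) (fineEmb Z₀) ↔ Y.1 ⊆ Z₀.1`. -/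
theorem within_fineEmb_fineEmb_iff (Y Z₀ : TDom 4 (R.F.L * R.cubesPerDir (k + 1))) :
    Within R (fineEmb hk Y) (fineEmb hk Z₀) ↔ Y.1 ⊆ Z₀.1 := by
  have hid : coarsen R k k = id := funext (B13InnerData.coarsen_self R k)
  rw [fineEmb_apply, fineEmb_apply, within_iff]
  simp only [le_refl, true_and]
  rw [hid, Finset.image_id]
  exact tdomCast_val_subset_iff _ Y Z₀

/-- [folklore] **THE CREW's REFINEMENT IS WELL-FORMEDNESS's «Z₀ WITHIN Z»**: the embedded refinement `trefineDom L N′ Z` of a scale-`(k+1)`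
domain `Z` lies `Within` `domEmb R (k+1) Z` (its block family IS `Z`: `TorusBlockRefinement.image_tcoarse_trefine`). -/
theorem within_fineEmb_trefineDom (Z : TDom 4 (R.cubesPerDir (k + 1))) :
    Within R (fineEmb hk (trefineDom R.F.L (R.cubesPerDir (k + 1)) Z)) (domEmb R (k + 1) Z) := by
  rw [within_fineEmb_domEmb_iff, trefineDom_val, image_tcoarse_trefine]

/-- [folklore] **`hmono` ON THE CARRIERS**: the linear size of a scale-`(k+1)` domain is at most that of its embedded refinement
(crew's `torusTreeLen_le_trefine`, [Dimock2013] Lemma 10's exact coarsening read upward). -/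
theorem d_domEmb_le_d_fineEmb_trefineDom (Z : TDom 4 (R.cubesPerDir (k + 1))) :
    R.carriers.d (domEmb R (k + 1) Z) ≤ R.carriers.d (fineEmb hk (trefineDom R.F.L (R.cubesPerDir (k + 1)) Z)) := by
  rw [d_fineEmb, domEmb_apply, TwoRuns.carriers_d]
  exact torusTreeLen_le_trefine Z

end Carriers

/-! ## §3 Row NE5's inner labels read from the fine torus -/

section Labels

variable {G : Type} [GaugeGroup G] {R : TwoRuns G} {k : ℕ} (hk : k + 1 + R.m' ≤ R.F.m + R.K)

/-- [folklore] **TRANSPORT OF INNER LABELS** `(Z₀, 𝐃, P) ↦ (fineEmb Z₀, 𝐃.map fineEmb, P)` (bonds are already the carriers' `Bnd R`). -/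
def InnerLabel.ofTorus (ℓ : InnerLabel (TDom 4 (R.F.L * R.cubesPerDir (k + 1))) (Bnd R)) : InnerLabel R.carriers.Dom (Bnd R) :=
  ⟨fineEmb hk ℓ.Z₀, ℓ.fam.map (fineEmb hk), ℓ.P⟩

/-- [folklore] The fields of the transported label. -/
@[simp] theorem InnerLabel.ofTorus_Z₀ (ℓ : InnerLabel (TDom 4 (R.F.L * R.cubesPerDir (k + 1))) (Bnd R)) : (InnerLabel.ofTorus hk ℓ).Z₀ = fineEmb hk ℓ.Z₀ :=
  rfl
/-- [folklore] The fields of the transported label. -/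
@[simp] theorem InnerLabel.ofTorus_fam (ℓ : InnerLabel (TDom 4 (R.F.L * R.cubesPerDir (k + 1))) (Bnd R)) :
    (InnerLabel.ofTorus hk ℓ).fam = ℓ.fam.map (fineEmb hk) := rfl
/-- [folklore] The fields of the transported label. -/
@[simp] theorem InnerLabel.ofTorus_P (ℓ : InnerLabel (TDom 4 (R.F.L * R.cubesPerDir (k + 1))) (Bnd R)) : (InnerLabel.ofTorus hk ℓ).P = ℓ.P :=
  rfl

/-- [folklore] The transport of labels is injective. -/
theorem InnerLabel.ofTorus_injective : Function.Injective (InnerLabel.ofTorus (R := R) hk) := by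
  intro ℓ₁ ℓ₂ h
  obtain ⟨a, b, c⟩ := ℓ₁
  obtain ⟨a', b', c'⟩ := ℓ₂
  simp only [InnerLabel.ofTorus, InnerLabel.mk.injEq] at h
  obtain ⟨h₁, h₂, h₃⟩ := h
  rw [(fineEmb hk).injective h₁, Finset.map_injective _ h₂, h₃]

/-- [folklore] **WELL-FORMEDNESS OF A TRANSPORTED LABEL, READ TORUS-SIDE**: at output level `k+1` under the polymer `domEmb R (k+1) Z`,
`(Z₀, 𝐃, P).ofTorus` is well formed iff every `Y ∈ 𝐃` has its cubes in `Z₀`, `P ⊆ bondsIn R (fineEmb Z₀)`, and the block family of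
`Z₀` lies in `Z` — the two catalogue clauses `Z₀ ∈ 𝐃_k`, `𝐃 ⊆ 𝐃_k` hold automatically. -/
theorem InnerLabel.wf_ofTorus_iff (ℓ : InnerLabel (TDom 4 (R.F.L * R.cubesPerDir (k + 1))) (Bnd R))
    (Z : TDom 4 (R.cubesPerDir (k + 1))) :
    (InnerLabel.ofTorus hk ℓ).WF (b13InnerData R) (k + 1) (domEmb R (k + 1) Z) ↔
      (∀ Y ∈ ℓ.fam, Y.1 ⊆ ℓ.Z₀.1) ∧ ℓ.P ⊆ bondsIn R (fineEmb hk ℓ.Z₀) ∧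
        ℓ.Z₀.1.image (tcoarse R.F.L (R.cubesPerDir (k + 1))) ⊆ Z.1 := by
  unfold InnerLabel.WF
  simp only [InnerLabel.ofTorus_Z₀, InnerLabel.ofTorus_fam, InnerLabel.ofTorus_P, B13InnerData.b13InnerData_innerLevel,
    B13InnerData.b13InnerData_bondsIn, b13InnerData_within, Finset.forall_mem_map, within_fineEmb_fineEmb_iff,
    within_fineEmb_domEmb_iff]
  constructor
  · rintro ⟨-, -, h₃, h₄, h₅⟩
    exact ⟨h₃, h₄, h₅⟩
  · rintro ⟨h₃, h₄, h₅⟩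
    refine ⟨fineEmb_mem_innerLevel hk _, ?_, h₃, h₄, h₅⟩
    intro X hX
    obtain ⟨Y, -, rfl⟩ := Finset.mem_map.1 hX
    exact fineEmb_mem_innerLevel hk Y

/-- [folklore] **MEMBERSHIP OF A TRANSPORTED LABEL IN ROW NE5's CATALOGUE, READ TORUS-SIDE** (`mem_innerLabels` ∘ `wf_ofTorus_iff`). -/
theorem InnerLabel.ofTorus_mem_innerLabels_iff (ℓ : InnerLabel (TDom 4 (R.F.L * R.cubesPerDir (k + 1))) (Bnd R))
    (Z : TDom 4 (R.cubesPerDir (k + 1))) :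
    InnerLabel.ofTorus hk ℓ ∈ innerLabels (b13InnerData R) (k + 1) (domEmb R (k + 1) Z) ↔
      (∀ Y ∈ ℓ.fam, Y.1 ⊆ ℓ.Z₀.1) ∧ ℓ.P ⊆ bondsIn R (fineEmb hk ℓ.Z₀) ∧
        ℓ.Z₀.1.image (tcoarse R.F.L (R.cubesPerDir (k + 1))) ⊆ Z.1 := by
  rw [mem_innerLabels, InnerLabel.wf_ofTorus_iff]

/-- [folklore] **EVERY WELL-FORMED LABEL AT A SCALE-`(k+1)` POLYMER IS A TRANSPORTED TORUS LABEL**: its `Z₀` and its family lie in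
`𝐃_k`, i.e. in the range of `fineEmb`. -/
theorem InnerLabel.exists_ofTorus_eq_of_wf {ℓ' : InnerLabel R.carriers.Dom (Bnd R)} {Z : TDom 4 (R.cubesPerDir (k + 1))}
    (h : ℓ'.WF (b13InnerData R) (k + 1) (domEmb R (k + 1) Z)) :
    ∃ ℓ : InnerLabel (TDom 4 (R.F.L * R.cubesPerDir (k + 1))) (Bnd R), InnerLabel.ofTorus hk ℓ = ℓ' := by
  classical
  obtain ⟨h₀, h₁, -, -, -⟩ := h
  rw [B13InnerData.b13InnerData_innerLevel, innerLevel_succ] at h₀ h₁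
  obtain ⟨Y₀, hY₀⟩ := exists_fineEmb_eq_of_mem_domAt hk h₀
  refine ⟨⟨Y₀, ℓ'.fam.preimage (fineEmb hk) (fineEmb hk).injective.injOn, ℓ'.P⟩, ?_⟩
  obtain ⟨a, b, c⟩ := ℓ'
  simp only [InnerLabel.ofTorus, InnerLabel.mk.injEq, and_true]
  refine ⟨hY₀, ?_⟩
  rw [Finset.map_eq_image, Finset.image_preimage, Finset.filter_true_of_mem]
  intro X hX
  obtain ⟨Y, hY⟩ := exists_fineEmb_eq_of_mem_domAt hk (h₁ hX)
  exact ⟨Y, hY⟩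

/-- [folklore] **THE TORUS LABELS OF A SCALE-`(k+1)` POLYMER**: the pull-back of row NE5's catalogue `innerLabels (b13InnerData R) (k+1)
(domEmb R (k+1) Z)` along the transport — a finite set of labels whose domains are fine-torus domains. -/
def torusLabels (Z : TDom 4 (R.cubesPerDir (k + 1))) : Finset (InnerLabel (TDom 4 (R.F.L * R.cubesPerDir (k + 1))) (Bnd R)) :=
  (innerLabels (b13InnerData R) (k + 1) (domEmb R (k + 1) Z)).preimage (InnerLabel.ofTorus hk)
    (InnerLabel.ofTorus_injective hk).injOn

/-- [folklore] Membership in the torus labels IS membership of the transported label in row NE5's catalogue. -/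
@[simp] theorem mem_torusLabels_iff' {Z : TDom 4 (R.cubesPerDir (k + 1))}
    {ℓ : InnerLabel (TDom 4 (R.F.L * R.cubesPerDir (k + 1))) (Bnd R)} :
    ℓ ∈ torusLabels hk Z ↔ InnerLabel.ofTorus hk ℓ ∈ innerLabels (b13InnerData R) (k + 1) (domEmb R (k + 1) Z) := by
  rw [torusLabels, Finset.mem_preimage]

/-- [folklore] **MEMBERSHIP IN THE TORUS LABELS, READ TORUS-SIDE**: the three geometric clauses of well-formedness. -/
theorem mem_torusLabels_iff {Z : TDom 4 (R.cubesPerDir (k + 1))} {ℓ : InnerLabel (TDom 4 (R.F.L * R.cubesPerDir (k + 1))) (Bnd R)} :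
    ℓ ∈ torusLabels hk Z ↔
      (∀ Y ∈ ℓ.fam, Y.1 ⊆ ℓ.Z₀.1) ∧ ℓ.P ⊆ bondsIn R (fineEmb hk ℓ.Z₀) ∧
        ℓ.Z₀.1.image (tcoarse R.F.L (R.cubesPerDir (k + 1))) ⊆ Z.1 := by
  rw [mem_torusLabels_iff', InnerLabel.ofTorus_mem_innerLabels_iff]

/-- [folklore] **ROW NE5's CATALOGUE AT A SCALE-`(k+1)` POLYMER IS THE IMAGE OF THE TORUS LABELS** under the (injective) transport. -/
theorem innerLabels_domEmb_eq_map_torusLabels (Z : TDom 4 (R.cubesPerDir (k + 1))) :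
    innerLabels (b13InnerData R) (k + 1) (domEmb R (k + 1) Z) =
      (torusLabels hk Z).map ⟨InnerLabel.ofTorus hk, InnerLabel.ofTorus_injective hk⟩ := by
  classical
  rw [torusLabels, Finset.map_eq_image]
  simp only [Function.Embedding.coeFn_mk]
  rw [Finset.image_preimage, eq_comm, Finset.filter_true_of_mem]
  intro ℓ' hℓ'
  obtain ⟨ℓ, hℓ⟩ := InnerLabel.exists_ofTorus_eq_of_wf hk ((mem_innerLabels _).1 hℓ')
  exact ⟨ℓ, hℓ⟩

/-- [folklore] **SUMS OVER ROW NE5's CATALOGUE TRANSPORT TO THE TORUS LABELS** (`Finset.sum_map`): for any summand `f` on labels,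
`Σ_{ℓ' ∈ innerLabels … (domEmb R (k+1) Z)} f ℓ' = Σ_{ℓ ∈ torusLabels Z} f (ℓ.ofTorus)` — so an owner-side filter `terms Z :=
(torusLabels Z).filter (fine Z)` sums inside the catalogue of record. -/
theorem sum_innerLabels_domEmb_eq {M : Type*} [AddCommMonoid M] (Z : TDom 4 (R.cubesPerDir (k + 1)))
    (f : InnerLabel R.carriers.Dom (Bnd R) → M) :
    ∑ ℓ' ∈ innerLabels (b13InnerData R) (k + 1) (domEmb R (k + 1) Z), f ℓ' =
      ∑ ℓ ∈ torusLabels hk Z, f (InnerLabel.ofTorus hk ℓ) := by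
  rw [innerLabels_domEmb_eq_map_torusLabels hk Z, Finset.sum_map]
  rfl

end Labels

end Summit.QuantumFields.BalabanUV.T4Continuum.SubstrateNestedToriOfRecord

end
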